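import Mathlib
import HarnessLib
import Literature.Probability.Percolation.MinOpenCut
import Literature.Probability.Percolation.MinOpenCutMenger
import Literature.Probability.Percolation.BKFinitary

/-!
# `stub_bkTail` of line `Sketch` (crux `BudgetTightness`, stmt-CriticalPhenomena-5248):
# a lower bound on the probability of the budget event bounds the expected min-cut

Registered stub `stub_bkTail` of the lead's skeleton `Cruxes/BudgetTightness/Lines/Sketch.lean`
(the `⇒` direction of the first-moment dictionary `BudgetTightness ⟺ bounded E[MinCut] i.o.`,
Hutchcroft's universal-tightness trick), proved here for an arbitrary countable graph, an
arbitrary finite region `S` and source / sink sets `A, B` with `A ∩ B ∩ S = ∅`, and then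
specialised to the annulus `MinCut(n, l n) = minOpenCutIn B(l n) B(n) ∂ⁱⁿB(l n)` of `ℤ³`.

Statement (`StubBkTail.integral_toNat_minOpenCutIn_le`): if `P_p(MinCut ≤ k) ≥ c > 0` then
`E_p[MinCut] ≤ (k + 1) / c`.

Proof (van den Berg–Kesten geometric tail for the path-packing number):
* MENGER (`maxDisjointOpenPathsIn_eq_minOpenCutIn`): on a finite region `t ≤ MinCut(ω)` yields `t`
  pairwise edge-disjoint open `A`–`B` walks inside `S` (`exists_walks_of_le_minOpenCutIn`);
* the level events `E_t = {t ≤ MinCut}` are increasing and finitary (the edges of the `t` walks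
  are a finite witness, `isFinitary_setOf_le_minOpenCutIn`), and `E_{j q} ⊆ □^j E_q` by splitting
  `j q` edge-disjoint walks into `j` groups of `q` (`mem_disjointOccurrenceList_replicate`), so the
  iterated BK inequality `bk_finitary_list` gives `P_p(E_{j q}) ≤ P_p(E_q)^j`
  (`real_setOf_mul_le_minOpenCutIn_le`);
* `E_{k+1} = {MinCut ≤ k}ᶜ` has probability `≤ 1 - c`, and pointwise
  `MinCut ≤ (k+1) (1 + Σ_{j=1}^{J} 𝟙_{E_{j(k+1)}})` (`J` = the budget of the all-open configuration,
  a uniform bound), whence `E[MinCut] ≤ (k+1) Σ_{j=0}^{J} (1-c)^j ≤ (k+1)/c`.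

No new definitions; helpers live in the sub-namespace `StubBkTail`.
-/

noncomputable section

namespace Summit.CriticalPhenomena.PercolationContinuityZ3.Theorems.BudgetTightness

open MeasureTheory ProbabilityTheory
open Literature.Probability.Percolation Literature.Probability.LatticeModels

namespace StubBkTail

variable {V : Type*}

/-! ### Open walks and sub-configurations -/

/-- The edges of a walk of the open graph of `ω` induced on `S` (pushed to `Sym2 V`) are open. -/
theorem map_mem_of_mem_edges {S : Set V} {ω : BondConfig V} {a b : S}
    (P : ((openGraph ω).induce S).Walk a b) {e : Sym2 S} (he : e ∈ P.edges) :
    Sym2.map Subtype.val e ∈ ω := by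
  have hadj := P.edges_subset_edgeSet he
  revert hadj
  induction e using Sym2.ind with
  | h u w =>
    intro hadj
    rw [SimpleGraph.mem_edgeSet, SimpleGraph.induce_adj, openGraph_adj] at hadj
    rw [Sym2.map_mk]
    exact hadj.1

/-- A family of `n` pairwise edge-disjoint open `A`–`B` walks inside `S` all of whose edges lie in
the configuration `K` witnesses `n ≤ maxDisjointOpenPathsIn S A B K` (transfer the walks to the
open graph of `K`). -/
theorem le_maxDisjointOpenPathsIn_of_forall_mem {S A B : Set V} {ω K : BondConfig V} {n : ℕ}
    (a b : Fin n → S) (P : ∀ i, ((openGraph ω).induce S).Walk (a i) (b i))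
    (hAB : ∀ i, (a i : V) ∈ A ∧ (b i : V) ∈ B)
    (hdisj : Pairwise fun i j => List.Disjoint (P i).edges (P j).edges)
    (hK : ∀ i, ∀ e ∈ (P i).edges, Sym2.map Subtype.val e ∈ K) :
    (n : ℕ∞) ≤ maxDisjointOpenPathsIn S A B K := by
  have hP : ∀ i, ∀ e, e ∈ (P i).edges → e ∈ ((openGraph K).induce S).edgeSet := by
    intro i e he
    have hadj := (P i).edges_subset_edgeSet he
    have heK := hK i e he
    revert hadj heK
    induction e using Sym2.ind with
    | h u w =>
      intro hadj heK
      rw [SimpleGraph.mem_edgeSet, SimpleGraph.induce_adj, openGraph_adj] at hadj ⊢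
      rw [Sym2.map_mk] at heK
      exact ⟨heK, hadj.2⟩
  refine le_maxDisjointOpenPathsIn a b (fun i => (P i).transfer _ (hP i)) hAB fun i j hij => ?_
  change List.Disjoint ((P i).transfer _ (hP i)).edges ((P j).transfer _ (hP j)).edges
  rw [SimpleGraph.Walk.edges_transfer, SimpleGraph.Walk.edges_transfer]
  exact hdisj hij

/-- **Menger extraction.** On a finite region, `t ≤ MinCut(ω)` yields `t` pairwise edge-disjoint
open `A`–`B` walks inside `S` (`maxDisjointOpenPathsIn_eq_minOpenCutIn`, and a supremum `≥ t` of
sizes of finite families is witnessed by a family of size `≥ t`, restricted to size `t`). -/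
theorem exists_walks_of_le_minOpenCutIn {S : Set V} (hS : S.Finite) {A B : Set V}
    {ω : BondConfig V} {t : ℕ} (ht : (t : ℕ∞) ≤ minOpenCutIn S A B ω) :
    ∃ (a b : Fin t → S) (P : ∀ i, ((openGraph ω).induce S).Walk (a i) (b i)),
      (∀ i, (a i : V) ∈ A ∧ (b i : V) ∈ B) ∧
        Pairwise fun i j => List.Disjoint (P i).edges (P j).edges := by
  rw [← maxDisjointOpenPathsIn_eq_minOpenCutIn hS] at ht
  obtain ⟨m, htm, a, b, P, hAB, hdisj⟩ : ∃ m, t ≤ m ∧ ∃ (a b : Fin m → S)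
      (P : ∀ i, ((openGraph ω).induce S).Walk (a i) (b i)),
      (∀ i, (a i : V) ∈ A ∧ (b i : V) ∈ B) ∧
        Pairwise fun i j => List.Disjoint (P i).edges (P j).edges := by
    rcases Nat.eq_zero_or_pos t with rfl | htpos
    · exact ⟨0, le_rfl, Fin.elim0, Fin.elim0, fun i => i.elim0, fun i => i.elim0,
        fun i => i.elim0⟩
    by_contra hcon
    push Not at hcon
    have hle : maxDisjointOpenPathsIn S A B ω ≤ ((t - 1 : ℕ) : ℕ∞) := by
      refine iSup₂_le fun m hm => ?_
      have hmt : m < t := by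
        by_contra hmt
        obtain ⟨a, b, P, hAB, hdisj⟩ := hm
        exact hcon m (not_lt.1 hmt) a b P hAB hdisj
      exact_mod_cast (show m ≤ t - 1 by omega)
    have := Nat.cast_le.1 (ht.trans hle)
    omega
  exact ⟨fun i => a (Fin.castLE htm i), fun i => b (Fin.castLE htm i),
    fun i => P (Fin.castLE htm i), fun i => hAB _,
    fun i j hij => hdisj fun h => hij (Fin.castLE_injective htm h)⟩

/-! ### The level events `{t ≤ MinCut}`: increasing, finitary, BK splitting -/

/-- The level event `{t ≤ MinCut}` is increasing (`minOpenCutIn_mono_config`). -/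
theorem isUpperSet_setOf_le_minOpenCutIn (S A B : Set V) (t : ℕ∞) :
    IsUpperSet {ω : BondConfig V | t ≤ minOpenCutIn S A B ω} :=
  fun _ _ hle h => le_trans h (minOpenCutIn_mono_config hle)

/-- The level event `{t ≤ MinCut}` on a finite region is finitary: the (finitely many) edges of
`t` pairwise edge-disjoint open walks form an open sub-configuration still in the event. -/
theorem isFinitary_setOf_le_minOpenCutIn {S : Set V} (hS : S.Finite) (A B : Set V) (t : ℕ) :
    IsFinitary {ω : BondConfig V | (t : ℕ∞) ≤ minOpenCutIn S A B ω} := by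
  classical
  intro ω hω
  obtain ⟨a, b, P, hAB, hdisj⟩ := exists_walks_of_le_minOpenCutIn hS hω
  refine ⟨Finset.univ.biUnion fun i => ((P i).edges.map (Sym2.map Subtype.val)).toFinset,
    ?_, ?_⟩
  · intro e he
    obtain ⟨i, -, hi⟩ := Finset.mem_biUnion.1 (Finset.mem_coe.1 he)
    obtain ⟨e', he', rfl⟩ := List.mem_map.1 (List.mem_toFinset.1 hi)
    exact map_mem_of_mem_edges (P i) he'
  · change (t : ℕ∞) ≤ minOpenCutIn S A B _
    refine (le_maxDisjointOpenPathsIn_of_forall_mem a b P hAB hdisj fun i e he => ?_).trans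
      (maxDisjointOpenPathsIn_le_minOpenCutIn _ _ _ _)
    exact Finset.mem_coe.2 (Finset.mem_biUnion.2
      ⟨i, Finset.mem_univ i, List.mem_toFinset.2 (List.mem_map.2 ⟨e, he, rfl⟩)⟩)

/-- **BK splitting.** On a finite region, `j · q ≤ MinCut(ω)` gives `j q` pairwise edge-disjoint
open walks, which split into `j` groups of `q`; the edge sets of the groups are pairwise disjoint
open witnesses of `{q ≤ MinCut}`, so `ω ∈ {q ≤ MinCut} □ ⋯ □ {q ≤ MinCut}` (`j` factors). -/
theorem mem_disjointOccurrenceList_replicate {S : Set V} (hS : S.Finite) {A B : Set V}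
    {ω : BondConfig V} {j q : ℕ} (h : ((j * q : ℕ) : ℕ∞) ≤ minOpenCutIn S A B ω) :
    ω ∈ disjointOccurrenceList
      (List.replicate j {ω' : BondConfig V | (q : ℕ∞) ≤ minOpenCutIn S A B ω'}) := by
  classical
  obtain ⟨a, b, P, hAB, hdisj⟩ := exists_walks_of_le_minOpenCutIn hS h
  set E : Set (BondConfig V) := {ω' | (q : ℕ∞) ≤ minOpenCutIn S A B ω'} with hE
  -- the index of the `i`-th walk of the `g`-th group
  set φ : Fin j → Fin q → Fin (j * q) := fun g i => finProdFinEquiv (g, i) with hφ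
  have hφinj : ∀ {g g' : Fin j} {i i' : Fin q}, φ g i = φ g' i' → g = g' ∧ i = i' := by
    intro g g' i i' hh
    exact Prod.mk_inj.1 (finProdFinEquiv.injective hh)
  -- the open edges of the `g`-th group
  set K : Fin j → Set (Sym2 V) := fun g =>
    {e | ∃ i, ∃ e' ∈ (P (φ g i)).edges, Sym2.map Subtype.val e' = e} with hK
  have hKω : ∀ g, K g ⊆ ω := by
    rintro g e ⟨i, e', he', rfl⟩
    exact map_mem_of_mem_edges _ he'
  have hKE : ∀ g, K g ∈ E := by
    intro g
    change (q : ℕ∞) ≤ minOpenCutIn S A B (K g)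
    refine (le_maxDisjointOpenPathsIn_of_forall_mem (fun i => a (φ g i)) (fun i => b (φ g i))
      (fun i => P (φ g i)) (fun i => hAB _)
      (fun i i' hii' => hdisj fun hh => hii' (hφinj hh).2)
      fun i e he => show ∃ i', ∃ e' ∈ (P (φ g i')).edges, Sym2.map Subtype.val e' = _ from
        ⟨i, e, he, rfl⟩).trans (maxDisjointOpenPathsIn_le_minOpenCutIn _ _ _ _)
  have hKdisj : Pairwise fun g g' => Disjoint (K g) (K g') := by
    intro g g' hgg'
    rw [Set.disjoint_left]
    rintro e ⟨i, e₁, he₁, rfl⟩ ⟨i', e₂, he₂, he⟩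
    have h12 : e₂ = e₁ := Sym2.map.injective Subtype.val_injective he
    have hne : φ g i ≠ φ g' i' := fun hh => hgg' (hφinj hh).1
    exact hdisj hne he₁ (h12 ▸ he₂)
  -- the witness list `[(E, K 0), …, (E, K (j-1))]`
  have hL : ((List.finRange j).map fun g => (E, K g)).map Prod.fst = List.replicate j E := by
    simp [Function.comp_def, List.map_const']
  rw [← hL]
  refine mem_disjointOccurrenceList_of_pairwise_disjoint _ ?_ ?_ ?_ ?_
  · intro x hx
    obtain ⟨g, -, rfl⟩ := List.mem_map.1 hx
    exact isUpperSet_setOf_le_minOpenCutIn S A B _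
  · intro x hx
    obtain ⟨g, -, rfl⟩ := List.mem_map.1 hx
    exact hKE g
  · rw [List.pairwise_map]
    exact List.Pairwise.imp (fun hne => hKdisj hne) (List.nodup_finRange j)
  · intro x hx
    obtain ⟨g, -, rfl⟩ := List.mem_map.1 hx
    exact hKω g

/-- **BK geometric tail** (iterated van den Berg–Kesten inequality `bk_finitary_list` for the
finitary increasing level events): `P_p(j q ≤ MinCut) ≤ P_p(q ≤ MinCut)^j` on a finite region. -/
theorem real_setOf_mul_le_minOpenCutIn_le [Countable V] (G : SimpleGraph V) (p : unitInterval)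
    {S : Set V} (hS : S.Finite) (A B : Set V) (j q : ℕ) :
    (bondPercolation G p).real {ω | ((j * q : ℕ) : ℕ∞) ≤ minOpenCutIn S A B ω} ≤
      (bondPercolation G p).real {ω | (q : ℕ∞) ≤ minOpenCutIn S A B ω} ^ j := by
  classical
  set E : Set (BondConfig V) := {ω | (q : ℕ∞) ≤ minOpenCutIn S A B ω} with hE
  calc (bondPercolation G p).real {ω | ((j * q : ℕ) : ℕ∞) ≤ minOpenCutIn S A B ω}
      ≤ (bondPercolation G p).real (disjointOccurrenceList (List.replicate j E)) :=
        measureReal_mono fun ω hω => mem_disjointOccurrenceList_replicate hS hω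
    _ ≤ ((List.replicate j E).map (bondPercolation G p).real).prod :=
        bk_finitary_list G p _
          (fun A' hA' => by
            rw [List.eq_of_mem_replicate hA']; exact isUpperSet_setOf_le_minOpenCutIn S A B _)
          (fun A' hA' => by
            rw [List.eq_of_mem_replicate hA']; exact isFinitary_setOf_le_minOpenCutIn hS A B q)
    _ = (bondPercolation G p).real E ^ j := by rw [List.map_replicate, List.prod_replicate]

/-- `{MinCut ≤ t}ᶜ = {t + 1 ≤ MinCut}` (in `ℕ∞`). -/
theorem compl_setOf_minOpenCutIn_le (S A B : Set V) (t : ℕ) :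
    {ω : BondConfig V | minOpenCutIn S A B ω ≤ (t : ℕ)}ᶜ =
      {ω | ((t + 1 : ℕ) : ℕ∞) ≤ minOpenCutIn S A B ω} := by
  ext ω
  rw [Set.mem_compl_iff, Set.mem_setOf_eq, Set.mem_setOf_eq, not_le, Nat.cast_succ,
    ENat.add_one_le_iff (ENat.coe_ne_top t)]

/-- The level events `{t ≤ MinCut}` of a finite region are measurable
(`measurableSet_setOf_minOpenCutIn_le` and the complement formula). -/
theorem measurableSet_setOf_le_minOpenCutIn {S : Set V} (hS : S.Finite) (A B : Set V) (t : ℕ) :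
    MeasurableSet {ω : BondConfig V | (t : ℕ∞) ≤ minOpenCutIn S A B ω} := by
  cases t with
  | zero => simp
  | succ t =>
    rw [← compl_setOf_minOpenCutIn_le]
    exact (measurableSet_setOf_minOpenCutIn_le hS A B t).compl

/-! ### The first-moment bound -/

/-- **BK tail bound for the expected min-cut** (Hutchcroft's universal-tightness trick, one
scale): on a finite region `S` with `A ∩ B ∩ S = ∅`, if `P_p(MinCut ≤ k) ≥ c > 0` then
`E_p[MinCut] ≤ (k + 1) / c`. Indeed `P_p((j+1)(k+1) ≤ MinCut) ≤ (1 - c)^{j+1}` by the BK geometric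
tail, and `MinCut ≤ (k+1)(1 + Σ_{j<J} 𝟙{(j+1)(k+1) ≤ MinCut})` pointwise. -/
theorem integral_toNat_minOpenCutIn_le [Countable V] (G : SimpleGraph V) (p : unitInterval)
    {S : Set V} (hS : S.Finite) {A B : Set V} (hAB : ∀ a ∈ S, a ∈ A → a ∉ B) {k : ℕ} {c : ℝ}
    (hc : 0 < c) (hck : c ≤ (bondPercolation G p).real {ω | minOpenCutIn S A B ω ≤ k}) :
    ∫ ω, ((minOpenCutIn S A B ω).toNat : ℝ) ∂(bondPercolation G p) ≤ ((k : ℝ) + 1) / c := by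
  classical
  set μ := bondPercolation G p with hμ
  -- a uniform bound: `MinCut(ω) ≤ MinCut(univ) = J < ⊤`
  have htop : minOpenCutIn S A B (Set.univ : BondConfig V) ≠ ⊤ := by
    rw [Ne, minOpenCutIn_eq_top_iff_of_finite hS]
    rintro ⟨a, haS, haA, haB⟩
    exact hAB a haS haA haB
  obtain ⟨J, hJ⟩ := ENat.ne_top_iff_exists.1 htop
  have hMJ : ∀ ω, minOpenCutIn S A B ω ≤ J := fun ω =>
    (minOpenCutIn_mono_config (Set.subset_univ ω)).trans hJ.symm.le
  -- the level events
  set E : ℕ → Set (BondConfig V) := fun t => {ω | (t : ℕ∞) ≤ minOpenCutIn S A B ω} with hE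
  have hEmeas : ∀ t, MeasurableSet (E t) := fun t => measurableSet_setOf_le_minOpenCutIn hS A B t
  -- `P(E (k+1)) ≤ 1 - c`
  have hPk : μ.real (E (k + 1)) ≤ 1 - c := by
    have : E (k + 1) = {ω | minOpenCutIn S A B ω ≤ (k : ℕ)}ᶜ :=
      (compl_setOf_minOpenCutIn_le S A B k).symm
    rw [this, measureReal_compl (measurableSet_setOf_minOpenCutIn_le hS A B k), probReal_univ]
    linarith
  have h1c : 0 ≤ 1 - c := measureReal_nonneg.trans hPk
  -- the BK geometric tail `P(E (j (k+1))) ≤ (1 - c)^j`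
  have hBK : ∀ j, μ.real (E (j * (k + 1))) ≤ (1 - c) ^ j := fun j =>
    (real_setOf_mul_le_minOpenCutIn_le G p hS A B j (k + 1)).trans
      (pow_le_pow_left₀ measureReal_nonneg hPk j)
  -- the dominating simple function
  set g : BondConfig V → ℝ := fun ω =>
    ((k : ℝ) + 1) * (1 + ∑ j ∈ Finset.range J, (E ((j + 1) * (k + 1))).indicator 1 ω) with hg
  have hind : ∀ j, Integrable ((E ((j + 1) * (k + 1))).indicator (1 : BondConfig V → ℝ)) μ :=
    fun j => (integrable_const (1 : ℝ)).indicator (hEmeas _)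
  have hsum : Integrable
      (fun ω => ∑ j ∈ Finset.range J, (E ((j + 1) * (k + 1))).indicator (1 : BondConfig V → ℝ) ω)
      μ :=
    integrable_finsetSum _ fun j _ => hind j
  have hgi : Integrable g μ := ((integrable_const (1 : ℝ)).add hsum).const_mul ((k : ℝ) + 1)
  have hintg : ∫ ω, g ω ∂μ =
      ((k : ℝ) + 1) * (1 + ∑ j ∈ Finset.range J, μ.real (E ((j + 1) * (k + 1)))) := by
    have h1 : ∀ j, ∫ ω, (E ((j + 1) * (k + 1))).indicator (1 : BondConfig V → ℝ) ω ∂μ =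
        μ.real (E ((j + 1) * (k + 1))) := fun j => integral_indicator_one (hEmeas _)
    simp only [hg]
    rw [integral_const_mul, integral_add (integrable_const _) hsum,
      integral_finsetSum _ fun j _ => hind j]
    simp only [h1, integral_const, probReal_univ, one_smul]
  -- pointwise domination `MinCut ≤ g`
  have hfg : ∀ ω, ((minOpenCutIn S A B ω).toNat : ℝ) ≤ g ω := by
    intro ω
    obtain ⟨m, hm⟩ :=
      ENat.ne_top_iff_exists.1 (ne_top_of_le_ne_top (ENat.coe_ne_top J) (hMJ ω))
    have hmJ : m ≤ J := by
      have := hMJ ω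
      rw [← hm] at this
      exact_mod_cast this
    rw [← hm, ENat.toNat_coe]
    set q := m / (k + 1) with hq
    have hqJ : q ≤ J := (Nat.div_le_self m (k + 1)).trans hmJ
    have hone : ∀ j ∈ Finset.range q,
        (E ((j + 1) * (k + 1))).indicator (1 : BondConfig V → ℝ) ω = 1 := by
      intro j hj
      rw [Finset.mem_range] at hj
      have hmem : ω ∈ E ((j + 1) * (k + 1)) := by
        change (((j + 1) * (k + 1) : ℕ) : ℕ∞) ≤ minOpenCutIn S A B ω
        rw [← hm]
        exact_mod_cast (Nat.mul_le_mul_right (k + 1) (Nat.succ_le_of_lt hj)).trans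
          (Nat.div_mul_le_self m (k + 1))
      rw [Set.indicator_of_mem hmem, Pi.one_apply]
    have hqle : (q : ℝ) ≤ ∑ j ∈ Finset.range J, (E ((j + 1) * (k + 1))).indicator 1 ω :=
      calc (q : ℝ) = ∑ j ∈ Finset.range q,
            (E ((j + 1) * (k + 1))).indicator (1 : BondConfig V → ℝ) ω := by
            rw [Finset.sum_congr rfl hone]; simp
        _ ≤ ∑ j ∈ Finset.range J, (E ((j + 1) * (k + 1))).indicator 1 ω :=
            Finset.sum_le_sum_of_subset_of_nonneg (Finset.range_mono hqJ)
              fun j _ _ => Set.indicator_nonneg (fun _ _ => zero_le_one) _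
    have hlt : m < (q + 1) * (k + 1) :=
      (Nat.div_lt_iff_lt_mul (Nat.succ_pos k)).1 (Nat.lt_succ_self q)
    have hlt' : (m : ℝ) + 1 ≤ ((q : ℝ) + 1) * ((k : ℝ) + 1) := by exact_mod_cast hlt
    have hmul := mul_le_mul_of_nonneg_left hqle (by positivity : (0 : ℝ) ≤ (k : ℝ) + 1)
    simp only [hg]
    linarith
  -- integrate and sum the geometric series
  calc ∫ ω, ((minOpenCutIn S A B ω).toNat : ℝ) ∂μ
      ≤ ∫ ω, g ω ∂μ :=
        integral_mono_of_nonneg (Filter.Eventually.of_forall fun ω => Nat.cast_nonneg _) hgi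
          (Filter.Eventually.of_forall hfg)
    _ = ((k : ℝ) + 1) * (1 + ∑ j ∈ Finset.range J, μ.real (E ((j + 1) * (k + 1)))) := hintg
    _ ≤ ((k : ℝ) + 1) * ∑ j ∈ Finset.range (J + 1), (1 - c) ^ j := by
        refine mul_le_mul_of_nonneg_left ?_ (by positivity)
        rw [Finset.sum_range_succ', pow_zero, add_comm]
        exact add_le_add_left (Finset.sum_le_sum fun j _ => hBK (j + 1)) 1
    _ ≤ ((k : ℝ) + 1) / c := by
        rw [le_div_iff₀ hc, mul_assoc]
        refine mul_le_of_le_one_right (by positivity) ?_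
        have hgeom := geom_sum_mul_neg (1 - c) (J + 1)
        rw [sub_sub_cancel] at hgeom
        rw [hgeom]
        linarith [pow_nonneg h1c (J + 1)]

/-! ### The annulus of `ℤ³` -/

-- adapted from the lead's `work/stubs/StubMarkov.lean` (`not_mem_innerBoundary_of_mem_box`)
/-- For `1 ≤ n`, `2 ≤ l` the inner box `B(n)` misses the inner vertex boundary of `B(l n)`. -/
theorem not_mem_innerBoundary_of_mem_box {n l : ℕ} (hn : 1 ≤ n) (hl : 2 ≤ l) {x : Site 3}
    (hx : x ∈ box 3 n) : x ∉ innerBoundary (zdGraph 3) (box 3 (l * n)) := by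
  intro hxb
  rw [mem_innerBoundary_iff] at hxb
  obtain ⟨-, y, hy, hadj⟩ := hxb
  rw [mem_box] at hx hy
  apply hy
  have hln : (n : ℤ) + 1 ≤ ((l * n : ℕ) : ℤ) := by push_cast; nlinarith
  rw [zdGraph_adj_iff] at hadj
  obtain ⟨i, h | h⟩ := hadj
  · intro j
    have hxj := hx j
    rw [h, Pi.add_apply]
    by_cases hji : j = i
    · subst hji; simp; constructor <;> omega
    · rw [Pi.single_eq_of_ne hji]; constructor <;> omega
  · intro j
    have hxj := hx j
    have : y j = x j - (Pi.single i (1 : ℤ) : Fin 3 → ℤ) j := by rw [h, Pi.add_apply]; ring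
    rw [this]
    by_cases hji : j = i
    · subst hji; simp; constructor <;> omega
    · rw [Pi.single_eq_of_ne hji]; constructor <;> omega

end StubBkTail

/-- **`stub_bkTail` (registered stub of line `Sketch`, crux stmt-CriticalPhenomena-5248): the BK
tail bound for the annulus min-cut of `ℤ³`.** For every `p`, `n ≥ 1`, `l ≥ 2`, `k` and `c > 0`:
if the budget event `{MinCut(n, l n) ≤ k}` (with `MinCut(n, l n) = minOpenCutIn B(l n) B(n)
∂ⁱⁿB(l n)`) has `P_p`-probability at least `c`, then `E_p[MinCut(n, l n)] ≤ (k + 1) / c`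
(`StubBkTail.integral_toNat_minOpenCutIn_le` on the finite region `B(l n)`, whose source `B(n)`
misses the sink `∂ⁱⁿB(l n)`). -/
theorem stub_bkTail :
    ∀ (p : unitInterval) (n l k : ℕ) (c : ℝ), 1 ≤ n → 2 ≤ l → 0 < c →
      c ≤ (bondPercolation (zdGraph 3) p).real
        {ω | minOpenCutIn (↑(box 3 (l * n)) : Set (Site 3)) (↑(box 3 n) : Set (Site 3))
          (↑(innerBoundary (zdGraph 3) (box 3 (l * n))) : Set (Site 3)) ω ≤ k} →
      ∫ ω, ((minOpenCutIn (↑(box 3 (l * n)) : Set (Site 3)) (↑(box 3 n) : Set (Site 3))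
          (↑(innerBoundary (zdGraph 3) (box 3 (l * n))) : Set (Site 3)) ω).toNat : ℝ)
          ∂(bondPercolation (zdGraph 3) p) ≤ ((k : ℝ) + 1) / c := by
  intro p n l k c hn hl hc hck
  exact StubBkTail.integral_toNat_minOpenCutIn_le (zdGraph 3) p (Finset.finite_toSet _)
    (fun a _ haA haB => StubBkTail.not_mem_innerBoundary_of_mem_box hn hl
      (Finset.mem_coe.1 haA) (Finset.mem_coe.1 haB)) hc hck

end Summit.CriticalPhenomena.PercolationContinuityZ3.Theorems.BudgetTightness

end
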